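import Mathlib
import Summits.NavierStokesRegularity.NavierStokesRegularity.Theorems.TypeIQuarterGateScarEnvelopeTypeIZoomDictionaryDefs
import Summits.NavierStokesRegularity.NavierStokesRegularity.Theorems.TypeIQuarterGateScarEnvelopeTypeIFatKill
import Summits.NavierStokesRegularity.NavierStokesRegularity.Theorems.TypeIQuarterGateScarEnvelopeTypeIBudgetViolators
import Summits.NavierStokesRegularity.NavierStokesRegularity.Theorems.TypeIQuarterGateScarEnvelopeTypeIOfNoTwinScarObject
import Summits.NavierStokesRegularity.NavierStokesRegularity.Theorems.TypeIQuarterGateQuarterLawTypeIGlue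
import Summits.NavierStokesRegularity.NavierStokesRegularity.Theorems.TypeIQuarterGateEnvelopeQuarterLaw
import Summits.NavierStokesRegularity.NavierStokesRegularity.Theorems.TypeIQuarterGateScarEnvelopeTypeINearOneRateDss
import Literature.Analysis.FluidPDE.AncientAxisymmetricTypeILiouville
import Summits.NavierStokesRegularity.NavierStokesRegularity.Theorems.TypeIQuarterGateScarEnvelopeTypeIZoomDictionaryLemmas
import Summits.NavierStokesRegularity.NavierStokesRegularity.Theorems.TypeIQuarterGateScarEnvelopeTypeIZoomDictionarySmallSatellites
import Summits.NavierStokesRegularity.NavierStokesRegularity.Theorems.TypeIQuarterGateScarEnvelopeTypeISatelliteTowerDefs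
import Summits.NavierStokesRegularity.NavierStokesRegularity.Theorems.TypeIQuarterGateScarEnvelopeTypeISatelliteTowerObjects
import Summits.NavierStokesRegularity.NavierStokesRegularity.Theorems.TypeIQuarterGateScarEnvelopeTypeISatelliteTowerClosure
import Summits.NavierStokesRegularity.NavierStokesRegularity.Theorems.TypeIQuarterGateScarEnvelopeTypeISatelliteTowerRooted

/-!
# Part K10, K11: THE SATELLITE CENSUS (normal form of a scar violator); scale covariance of the A–B class

Part K10–K11 of the plate: abstract `chain_dichotomy` (dependent choice), tower nodes, `towerNode_step` (T3+T1), ★ `satellite_census`, `oneScar_of_tameNode`, ★★★ `census_of_not_scarEnvelopeTypeI`; K11 `abTower_zoom` (parabolic similarity invariance of `ABTower M`), `twinScar_of_rootedNode`, `abTower_not_nearOneDss` (the DSS-wall rung `nearOneRateDss_proof` by name) and `census_of_not_scarEnvelopeTypeI₂`.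

PROVENANCE: declaration texts VERBATIM from the HOME plates of the instrument seat nsreg-p3 (g24/g25, cell
`pub/ns-regularity-ideate`): `round-31/Tangent31prep.lean` v5 (sha16 `e5b8668e3a090216`; = ROUND-30 plate v10 + Part K) and,
for Part L, `round-32/Tangent32prep.lean` v6 (sha16 `6123f27718636121`);
the author cannot write under `Theorems/` (`perm.theorems-prover-only`); landed by the
LEAD-lineage prover ns-sz-p1 g5 on director-ns DIRECTOR-NS #218 (2), split into ≤ 400-line modules (the
plate's `def`s gathered in `TypeIQuarterGateScarEnvelopeTypeIZoomDictionaryDefs`), namespace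
`Summit.NavierStokesRegularity.NavierStokesRegularity.Cruxes.ScarEnvelopeTypeI.ZoomDictionary` (the plate's `NsregP3.R30P`), `E3` spelled out, one-line docstrings
added where the plate had none.  `--supports stmt-NavierStokesRegularity-23843 --as helper`.

HONEST FRAMING: dictionary / census TOOLING for the crux `TypeIQuarterGate.ScarEnvelopeTypeI` (item 23843):
equivalences and normal forms, kernel-checked; NO open statement is proved — 23843, its parent
`QuarterLawTypeI` (23726), the route and Navier–Stokes regularity are OPEN; hard core evaded: none.
-/

-- the summit-side namespace repeats a component by design (single-conjunct summit, D-0017)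
set_option linter.dupNamespace false

open MeasureTheory Set Metric Filter Topology
open scoped ENNReal

namespace Summit.NavierStokesRegularity.NavierStokesRegularity.Cruxes.ScarEnvelopeTypeI.ZoomDictionary

variable {u : ℝ → (EuclideanSpace ℝ (Fin 3)) → (EuclideanSpace ℝ (Fin 3))} {a : (EuclideanSpace ℝ (Fin 3))} {ν T : ℝ}

section Tower

open Literature.Analysis.FluidPDE
variable {U : ℝ → (EuclideanSpace ℝ (Fin 3)) → (EuclideanSpace ℝ (Fin 3))} {P : ℝ → (EuclideanSpace ℝ (Fin 3)) → ℝ} {y' : (EuclideanSpace ℝ (Fin 3))} {ν : ℝ}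
open Summit.NavierStokesRegularity.NavierStokesRegularity.Cruxes.ScarEnvelopeTypeI.ScarZoom
  (CruxHypotheses ScarViolators TwinScarObject singularAt_of_isBackwardSingularPoint
    exists_localEnergy_of_typeIBound) in

/-! ### K10. THE SATELLITE CENSUS (normal form of a scar violator)

Nodes of the tower are A–B objects with a chosen satellite; a node DESCENDS to another when the
latter's field is (a.e. on every `Q_R(0)`, `R < 1`) a tangent flow at the chosen satellite and the new
satellite lies in the open unit ball.  `towerNode_step` (= T3 `tame_or_descends` + T1 `abTower_closed`
+ a.e.-invariance of `RegPt` inside the unit ball) says every node is TAME or DESCENDS; the abstract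
`chain_dichotomy` (dependent choice) turns this into the census: from every node there is EITHER a
finite descending chain ending at a TAME node OR an infinite descending chain of non-tame nodes.
With T0 (`exists_abTower_of_not_scarEnvelopeTypeI`): if the crux item 23843 fails, such a census
tree is rooted at a twin-scar object (`census_of_not_scarEnvelopeTypeI`).  At a tame node all tangent
flows are ONE-SCAR flows (`oneScar_of_tameNode`: singular at the origin by T2, regular at every other
point of the unit ball by the dictionary K6 ★). -/

/-- Abstract census (dependent choice): if every admissible point is good or has an admissible
successor, then from any admissible point there is a finite chain to a good point or an infinite chain
of non-good points. -/
theorem chain_dichotomy {α : Type*} (N Good : α → Prop) (Rel : α → α → Prop)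
    (h : ∀ a, N a → Good a ∨ ∃ b, N b ∧ Rel a b) {a₀ : α} (ha₀ : N a₀) :
    (∃ (f : ℕ → α) (k : ℕ), f 0 = a₀ ∧ (∀ i < k, Rel (f i) (f (i + 1))) ∧ (∀ i ≤ k, N (f i)) ∧
        Good (f k)) ∨
      ∃ f : ℕ → α, f 0 = a₀ ∧ ∀ k, N (f k) ∧ ¬ Good (f k) ∧ Rel (f k) (f (k + 1)) := by
  classical
  by_cases hfin : ∃ (f : ℕ → α) (k : ℕ), f 0 = a₀ ∧ (∀ i < k, Rel (f i) (f (i + 1))) ∧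
      (∀ i ≤ k, N (f i)) ∧ Good (f k)
  · exact Or.inl hfin
  right
  -- `Bad a`: admissible and no finite good chain starts at `a`
  let Bad : α → Prop := fun a => N a ∧ ¬ ∃ (f : ℕ → α) (k : ℕ), f 0 = a ∧
    (∀ i < k, Rel (f i) (f (i + 1))) ∧ (∀ i ≤ k, N (f i)) ∧ Good (f k)
  have hstep : ∀ a, Bad a → ∃ b, Rel a b ∧ Bad b := by
    rintro a ⟨hNa, hno⟩
    have hng : ¬ Good a := fun hg =>
      hno ⟨fun _ => a, 0, rfl, fun i hi => absurd hi (Nat.not_lt_zero i), fun i _ => hNa, hg⟩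
    obtain ⟨b, hNb, hRab⟩ := (h a hNa).resolve_left hng
    refine ⟨b, hRab, hNb, ?_⟩
    rintro ⟨g, k, hg0, hgR, hgN, hgk⟩
    refine hno ⟨fun i => match i with | 0 => a | j + 1 => g j, k + 1, rfl, ?_, ?_, hgk⟩
    · intro i hi
      cases i with
      | zero =>
        show Rel a (g 0)
        rw [hg0]
        exact hRab
      | succ j => exact hgR j (by omega)
    · intro i hi
      cases i with
      | zero => exact hNa
      | succ j => exact hgN j (by omega)
  have hBad0 : Bad a₀ := ⟨ha₀, hfin⟩
  have hstep' : ∀ b : {a // Bad a}, ∃ b' : {a // Bad a}, Rel b.1 b'.1 := by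
    intro b
    obtain ⟨b', hR, hB⟩ := hstep b.1 b.2
    exact ⟨⟨b', hB⟩, hR⟩
  choose g hg using hstep'
  refine ⟨fun n => (g^[n] ⟨a₀, hBad0⟩).1, rfl, fun k => ⟨(g^[k] ⟨a₀, hBad0⟩).2.1, fun hgood =>
    (g^[k] ⟨a₀, hBad0⟩).2.2 ⟨fun _ => (g^[k] ⟨a₀, hBad0⟩).1, 0, rfl,
      fun i hi => absurd hi (Nat.not_lt_zero i), fun i _ => (g^[k] ⟨a₀, hBad0⟩).2.1, hgood⟩, ?_⟩⟩
  show Rel (g^[k] ⟨a₀, hBad0⟩).1 (g^[k + 1] ⟨a₀, hBad0⟩).1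
  rw [Function.iterate_succ_apply']
  exact hg _

/-- `RegPt` at a point of the open unit ball only sees a.e. values on `Q_R(0)` for some `R < 1`. -/
theorem regPt_of_ae_eq_of_norm_lt_one {Ū U' : ℝ → (EuclideanSpace ℝ (Fin 3)) → (EuclideanSpace ℝ (Fin 3))} {y : (EuclideanSpace ℝ (Fin 3))}
    (hae : ∀ R ∈ Ioo (0 : ℝ) 1,
      ∀ᵐ z ∂(volume.restrict (parabolicCylinder R (0 : ℝ × (EuclideanSpace ℝ (Fin 3))))), Ū z.1 z.2 = U' z.1 z.2)
    (hy : ‖y‖ < 1) (h : RegPt Ū y) : RegPt U' y := by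
  obtain ⟨r, hr, M, hM⟩ := h
  set r' : ℝ := min r ((1 - ‖y‖) / 2) with hr'
  have hr'0 : 0 < r' := lt_min hr (by linarith)
  have hr'r : r' ≤ r := min_le_left _ _
  have hr'1 : r' ≤ (1 - ‖y‖) / 2 := min_le_right _ _
  set R : ℝ := ‖y‖ + r' with hR
  have hR0 : 0 < R := by positivity
  have hR1 : R < 1 := by rw [hR]; linarith
  have hsub : parabolicCylinder r' ((0 : ℝ), y) ⊆ parabolicCylinder R (0 : ℝ × (EuclideanSpace ℝ (Fin 3))) :=
    parabolicCylinder_subset_zero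
      (pow_le_pow_left₀ hr'0.le (by rw [hR]; linarith [norm_nonneg y]) 2) le_rfl
  have hsub' : parabolicCylinder r' ((0 : ℝ), y) ⊆ parabolicCylinder r ((0 : ℝ), y) :=
    parabolicCylinder_mono hr'0.le hr'r _
  refine ⟨r', hr'0, M, ?_⟩
  filter_upwards [ae_restrict_of_ae_restrict_of_subset hsub (hae R ⟨hR0, hR1⟩),
    ae_restrict_of_ae_restrict_of_subset hsub' hM] with z hz hzM
  rw [← hz]
  exact hzM

/-- `RegPt` at a point of the open unit ball depends only on the a.e.-class of the flow on the cylinders `Q_R(0)`, `R < 1`. [folklore] -/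
theorem regPt_iff_of_ae_eq_of_norm_lt_one {Ū U' : ℝ → (EuclideanSpace ℝ (Fin 3)) → (EuclideanSpace ℝ (Fin 3))} {y : (EuclideanSpace ℝ (Fin 3))}
    (hae : ∀ R ∈ Ioo (0 : ℝ) 1,
      ∀ᵐ z ∂(volume.restrict (parabolicCylinder R (0 : ℝ × (EuclideanSpace ℝ (Fin 3))))), Ū z.1 z.2 = U' z.1 z.2)
    (hy : ‖y‖ < 1) : RegPt Ū y ↔ RegPt U' y :=
  ⟨regPt_of_ae_eq_of_norm_lt_one hae hy,
    regPt_of_ae_eq_of_norm_lt_one (fun R hR => (hae R hR).mono fun _ hz => hz.symm) hy⟩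

/-- **The census step**: every admissible node is tame or descends to an admissible node
(T3 `tame_or_descends` + T1 `abTower_closed`). -/
theorem towerNode_step (M : ℝ) :
    ∀ n : TNode, TowerNode M n → TameNode n ∨ ∃ n' : TNode, TowerNode M n' ∧ Descends n n' := by
  rintro ⟨U, P, H, y⟩ ⟨hAB, hy⟩
  rcases tame_or_descends (towerObj_of_abTower hAB) hy with htame | ⟨L, Ū, ht, y'', hy'', hy''1⟩
  · exact Or.inl htame
  · obtain ⟨U', P', H', hAB', hae⟩ := abTower_closed hAB ht
    refine Or.inr ⟨⟨U', P', H', y''⟩, ⟨hAB', hy''.1, fun hreg => hy''.2 ?_⟩, L, Ū, ht, hae, hy''1⟩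
    exact regPt_of_ae_eq_of_norm_lt_one (fun R hR => (hae R hR).mono fun _ hz => hz.symm) hy''1 hreg

/-- **THE SATELLITE CENSUS.**  From every admissible node: EITHER a finite descending chain of
admissible nodes ending at a TAME node, OR an infinite descending chain of admissible NON-tame
nodes. -/
theorem satellite_census {M : ℝ} {n₀ : TNode} (h₀ : TowerNode M n₀) :
    (∃ (c : ℕ → TNode) (k : ℕ), c 0 = n₀ ∧ (∀ i < k, Descends (c i) (c (i + 1))) ∧
        (∀ i ≤ k, TowerNode M (c i)) ∧ TameNode (c k)) ∨
      ∃ c : ℕ → TNode, c 0 = n₀ ∧ ∀ k, TowerNode M (c k) ∧ ¬ TameNode (c k) ∧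
        Descends (c k) (c (k + 1)) :=
  chain_dichotomy (TowerNode M) TameNode Descends (towerNode_step M) h₀

/-- **At a tame node every tangent flow is a ONE-SCAR flow**: singular at the origin (T2) and
regular at every other point of the open unit ball (dictionary K6 ★). -/
theorem oneScar_of_tameNode {M : ℝ} {n : TNode} (hn : TowerNode M n) (ht : TameNode n)
    {L : ℕ → ℝ} {Ū : ℝ → (EuclideanSpace ℝ (Fin 3)) → (EuclideanSpace ℝ (Fin 3))} (hŪ : TangentU n.U n.P n.y 0 L Ū) :
    ¬ RegPt Ū 0 ∧ ∀ y'' : (EuclideanSpace ℝ (Fin 3)), y'' ≠ 0 → ‖y''‖ < 1 → RegPt Ū y'' :=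
  ⟨towerPersists_holds M n.U n.P (towerObj_of_abTower hn.1) n.y hn.2 L Ū hŪ,
    (abTower_dictionary_inBall hn.1 n.y).1 ht.2 L Ū hŪ⟩

open Summit.NavierStokesRegularity.NavierStokesRegularity.Cruxes.ScarEnvelopeTypeI in
/-- **NORMAL FORM OF A SCAR VIOLATOR.**  If the crux item 23843 fails, there are a rate `M` and a
ROOT node — an `ABTower` twin-scar object `U₀` (singular at the origin) with a satellite `y₀` on the
unit sphere — from which the satellite census holds: a finite descending chain to a TAME satellite
(all of whose tangent flows are one-scar flows, `oneScar_of_tameNode`), or an infinite descending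
chain of non-tame satellites, every level an `ABTower` object.  (OPEN: neither branch is excluded
here; 23843, its parent 23726 and N0 remain open.) -/
theorem census_of_not_scarEnvelopeTypeI
    (h : ¬ Summit.NavierStokesRegularity.NavierStokesRegularity.Theses.TypeIQuarterGate.ScarEnvelopeTypeI) :
    ∃ (M : ℝ) (n₀ : TNode), TowerNode M n₀ ∧ ScarZoom.TwinScarObject M n₀.U ∧ ¬ RegPt n₀.U 0 ∧
      ‖n₀.y‖ = 1 ∧
      ((∃ (c : ℕ → TNode) (k : ℕ), c 0 = n₀ ∧ (∀ i < k, Descends (c i) (c (i + 1))) ∧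
          (∀ i ≤ k, TowerNode M (c i)) ∧ TameNode (c k)) ∨
        ∃ c : ℕ → TNode, c 0 = n₀ ∧ ∀ k, TowerNode M (c k) ∧ ¬ TameNode (c k) ∧
          Descends (c k) (c (k + 1))) := by
  obtain ⟨M, U, P, H, e, hAB, hTS, h0, he, he1⟩ := exists_abTower_of_not_scarEnvelopeTypeI h
  exact ⟨M, ⟨U, P, H, e⟩, ⟨hAB, he⟩, hTS, h0, he1, satellite_census ⟨hAB, he⟩⟩

/-! ### K11. Scale covariance of the A–B class; EVERY level of the tower is a twin-scar object;
NO level is near-one DSS (the DSS-wall rung `AxisActivity.nearOneRateDss_proof`, tree, BY NAME)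

The class `ABTower M` is invariant under the parabolic similarities `U ↦ c U(c²·, x₀ + c·)`
about final-time points (KNSS (1.2) for the mild clause, `IsSuitableWeakSolutionInBall.zoom/zoomOut`
for the local energy class on all balls, `HasWeakSpatialGradientOn.stRescale` and
`typeIBound_nsZoom` for A–B's quantity).  Consequences for the census: every node of a census chain
is ROOTED (singular at the origin: T2 transported through the a.e. identification), every rooted
node is — after the similarity that puts its satellite on the unit sphere — a TWIN-SCAR OBJECT of
the SAME rate `M` (so the deciding stub S_C′ «no twin-scar object of rate M» is met again at every
level), and no rooted node is `c`-DSS about any centre for `1 < c < c₁(M)` (the DSS-wall rung in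
the rate class, `nearOneRateDss_proof`, used by name). -/

/-- The parabolic affine map about a final-time point preserves the open lower slab `{s < 0}` (preimage form). [folklore] -/
theorem stAffine_preimage_lowerSlab {c : ℝ} (hc : 0 < c) (x₀ : (EuclideanSpace ℝ (Fin 3))) :
    stAffine (c ^ 2) c (0 : ℝ) x₀ ⁻¹' (Iio (0 : ℝ) ×ˢ (univ : Set (EuclideanSpace ℝ (Fin 3)))) = Iio (0 : ℝ) ×ˢ univ := by
  have hc2 : 0 < c ^ 2 := pow_pos hc 2
  ext ⟨s, y⟩
  simp only [mem_preimage, stAffine_apply, mem_prod, mem_Iio, mem_univ, and_true, zero_add]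
  exact ⟨fun h => neg_of_mul_neg_right h hc2.le, fun h => mul_neg_of_pos_of_neg hc2 h⟩

/-- The parabolic affine map about a final-time point preserves the open lower slab `{s < 0}` (`stPreimage` form). [folklore] -/
theorem stPreimage_lowerSlab {c : ℝ} (hc : 0 < c) (x₀ : (EuclideanSpace ℝ (Fin 3))) :
    stPreimage (c ^ 2) c (0 : ℝ) x₀ (slab (EuclideanSpace ℝ (Fin 3)) (Iio 0) isOpen_Iio) = slab (EuclideanSpace ℝ (Fin 3)) (Iio 0) isOpen_Iio :=
  TopologicalSpace.Opens.ext (by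
    rw [coe_stPreimage, coe_slab]
    exact stAffine_preimage_lowerSlab hc x₀)

/-- **The A–B class is invariant under parabolic similarities about final-time points**, with the
same rate `M`. -/
theorem abTower_zoom {M : ℝ} {H : ℝ → (EuclideanSpace ℝ (Fin 3)) → (EuclideanSpace ℝ (Fin 3)) →L[ℝ] (EuclideanSpace ℝ (Fin 3))} (h : ABTower M U P H) (x₀ : (EuclideanSpace ℝ (Fin 3)))
    {c : ℝ} (hc : 0 < c) :
    ABTower M (c • stPull (c ^ 2) c (0 : ℝ) x₀ U) (c ^ 2 • stPull (c ^ 2) c (0 : ℝ) x₀ P)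
      (c ^ 2 • stPull (c ^ 2) c (0 : ℝ) x₀ H) := by
  obtain ⟨hmild, hIB, hH, hI⟩ := h
  refine ⟨?_, fun a ha => ?_, ?_, ?_⟩
  · have h1 := (hmild.comp_add_right x₀).nsRescale hc
    convert h1 using 1
    funext s y
    simp only [smul_stPull_apply, nsRescale_apply, zero_add]
    rw [add_comm x₀]
  · have hz₀sub := parabolicCylinder_subset_lowerHalf (a * c) x₀
    have hρ0 : 0 < a * c := mul_pos ha hc
    have hsub : parabolicCylinder (a * c) (((0 : ℝ), x₀) : ℝ × (EuclideanSpace ℝ (Fin 3))) ⊆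
        parabolicCylinder (‖x₀‖ + a * c) (0 : ℝ × (EuclideanSpace ℝ (Fin 3))) :=
      parabolicCylinder_subset_zero (pow_le_pow_left₀ hρ0.le (by linarith [norm_nonneg x₀]) 2)
        le_rfl
    have h0 : IsSuitableWeakSolutionInBall (a * c) (((0 : ℝ), x₀) : ℝ × (EuclideanSpace ℝ (Fin 3))) U P :=
      (hIB (‖x₀‖ + a * c) (by positivity)).of_subset_zero (z := ((0 : ℝ), x₀)) hρ0 hsub
    have h1 := h0.zoom hρ0
    have hc'0 : 0 < c / (a * c) := div_pos hc hρ0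
    have h2 := h1.zoomOut hc'0
    have hcρ : c / (a * c) * (a * c) = c := div_mul_cancel₀ _ hρ0.ne'
    have hrad : 1 / (c / (a * c)) = a := by
      rw [one_div_div, mul_div_cancel_right₀ _ hc.ne']
    rw [zoom_zoom, zoom_zoom, hcρ, hrad,
      show (c / (a * c)) ^ 2 * (a * c) ^ 2 = c ^ 2 by rw [← mul_pow, hcρ]] at h2
    exact h2
  · have h1 := hH.stRescale c (β := c ^ 2) (γ := c) (pow_pos hc 2) hc (0 : ℝ) x₀
    rw [show c * c = c ^ 2 by ring, stPreimage_lowerSlab hc x₀] at h1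
    exact h1
  · rw [← stAffine_preimage_lowerSlab hc x₀, typeIBound_nsZoom hc (0 : ℝ) x₀]
    exact hI

open Summit.NavierStokesRegularity.NavierStokesRegularity.Cruxes.ScarEnvelopeTypeI in
/-- Essential unboundedness near `(0, y)` implies pointwise unboundedness there. -/
theorem singularAt_of_not_regPt {U : ℝ → (EuclideanSpace ℝ (Fin 3)) → (EuclideanSpace ℝ (Fin 3))} {y : (EuclideanSpace ℝ (Fin 3))} (h : ¬ RegPt U y) :
    ScarZoom.SingularAt U y := by
  intro r hr A
  by_contra hcon
  push Not at hcon
  refine h ⟨r, hr, A, ?_⟩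
  refine (ae_restrict_mem (isOpen_parabolicCylinder r _).measurableSet).mono fun z hz => ?_
  rw [mem_parabolicCylinder] at hz
  obtain ⟨⟨h1, h2⟩, h3⟩ := hz
  exact hcon z.1 ⟨by simpa using h1, by simpa using h2⟩ z.2 (mem_ball.2 (by simpa using h3))

/-- Descent preserves rootedness (T2 `towerPersists_holds` through the a.e. identification). -/
theorem not_regPt_zero_of_descends {M : ℝ} {n n' : TNode} (hn : TowerNode M n)
    (hd : Descends n n') : ¬ RegPt n'.U 0 := by
  obtain ⟨L, Ū, ht, hae, -⟩ := hd
  have h0 : ¬ RegPt Ū 0 :=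
    towerPersists_holds M n.U n.P (towerObj_of_abTower hn.1) n.y hn.2 L Ū ht
  exact fun h => h0 ((regPt_iff_of_ae_eq_of_norm_lt_one hae (by simp)).2 h)

/-- The census step on rooted nodes. -/
theorem rootedNode_step (M : ℝ) :
    ∀ n : TNode, RootedNode M n → TameNode n ∨ ∃ n' : TNode, RootedNode M n' ∧ Descends n n' := by
  intro n hn
  rcases towerNode_step M n hn.1 with ht | ⟨n', hn', hd⟩
  · exact Or.inl ht
  · exact Or.inr ⟨n', ⟨hn', not_regPt_zero_of_descends hn.1 hd⟩, hd⟩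

/-- **The rooted census**: as `satellite_census`, every node singular at the origin. -/
theorem rooted_census {M : ℝ} {n₀ : TNode} (h₀ : RootedNode M n₀) :
    (∃ (c : ℕ → TNode) (k : ℕ), c 0 = n₀ ∧ (∀ i < k, Descends (c i) (c (i + 1))) ∧
        (∀ i ≤ k, RootedNode M (c i)) ∧ TameNode (c k)) ∨
      ∃ c : ℕ → TNode, c 0 = n₀ ∧ ∀ k, RootedNode M (c k) ∧ ¬ TameNode (c k) ∧
        Descends (c k) (c (k + 1)) :=
  chain_dichotomy (RootedNode M) TameNode Descends (rootedNode_step M) h₀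

open Summit.NavierStokesRegularity.NavierStokesRegularity.Cruxes.ScarEnvelopeTypeI in
/-- **No rooted `ABTower` field is near-one DSS about any centre** — the DSS-wall rung in the rate
class (`AxisActivity.nearOneRateDss_proof`, tree) read on the tower: the threshold `c₁(M)` depends
on the rate only, hence is UNIFORM along every census chain. -/
theorem abTower_not_nearOneDss (M : ℝ) :
    ∃ c₁ : ℝ, 1 < c₁ ∧ ∀ c : ℝ, 1 < c → c < c₁ →
      ∀ (U : ℝ → (EuclideanSpace ℝ (Fin 3)) → (EuclideanSpace ℝ (Fin 3))) (P : ℝ → (EuclideanSpace ℝ (Fin 3)) → ℝ) (H : ℝ → (EuclideanSpace ℝ (Fin 3)) → (EuclideanSpace ℝ (Fin 3)) →L[ℝ] (EuclideanSpace ℝ (Fin 3))), ABTower M U P H →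
        ¬ RegPt U 0 → ∀ x₀ : (EuclideanSpace ℝ (Fin 3)), ¬ IsDiscretelySelfSimilar c (fun t x => U t (x + x₀)) := by
  obtain ⟨c₁, hc₁, h⟩ := AxisActivity.nearOneRateDss_proof M
  refine ⟨c₁, hc₁, fun c hc hcc U P H hAB h0 x₀ hdss => h0 ?_⟩
  have hzero := h c hc hcc _ (hAB.1.comp_add_right x₀) hdss
  refine ⟨1, one_pos, 0,
    (ae_restrict_mem (isOpen_parabolicCylinder 1 _).measurableSet).mono fun z hz => ?_⟩
  have hz1 : z.1 < 0 := (Set.mem_prod.1 (parabolicCylinder_subset_lowerHalf 1 (0 : (EuclideanSpace ℝ (Fin 3))) hz)).1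
  have h1 := hzero z.1 hz1 (z.2 - x₀)
  rw [sub_add_cancel] at h1
  rw [h1, norm_zero]

open Summit.NavierStokesRegularity.NavierStokesRegularity.Cruxes.ScarEnvelopeTypeI in
/-- **Every rooted node is a twin-scar object of the same rate after normalisation**: the parabolic
similarity about the origin with factor `‖n.y‖` keeps the class (`abTower_zoom`), keeps the origin
singular and puts the satellite on the unit sphere; Seregin's scaled energy comes from A–B's
quantity (`ScarZoom.exists_localEnergy_of_typeIBound`, tree). -/
theorem twinScar_of_rootedNode {M : ℝ} {n : TNode} (hn : RootedNode M n) :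
    ∃ n' : TNode, RootedNode M n' ∧ ‖n'.y‖ = 1 ∧ ScarZoom.TwinScarObject M n'.U ∧
      n'.U = ‖n.y‖ • stPull (‖n.y‖ ^ 2) ‖n.y‖ (0 : ℝ) (0 : (EuclideanSpace ℝ (Fin 3))) n.U := by
  obtain ⟨⟨hAB, hy0, hyreg⟩, h0⟩ := hn
  have hρ0 : 0 < ‖n.y‖ := norm_pos_iff.2 hy0
  have hAB' := abTower_zoom hAB 0 hρ0
  have hV0 : ¬ RegPt (‖n.y‖ • stPull (‖n.y‖ ^ 2) ‖n.y‖ (0 : ℝ) (0 : (EuclideanSpace ℝ (Fin 3))) n.U) 0 := by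
    intro h
    refine h0 (regPt_of_zoomIn hρ0 (y' := 0) ?_)
    rwa [smul_zero]
  have hVe : ¬ RegPt (‖n.y‖ • stPull (‖n.y‖ ^ 2) ‖n.y‖ (0 : ℝ) (0 : (EuclideanSpace ℝ (Fin 3))) n.U) (‖n.y‖⁻¹ • n.y) :=
    fun h => hyreg (regPt_of_zoomIn hρ0 h)
  have he1 : ‖(‖n.y‖⁻¹ • n.y : (EuclideanSpace ℝ (Fin 3)))‖ = 1 := by
    rw [norm_smul, norm_inv, norm_norm, inv_mul_cancel₀ hρ0.ne']
  have he0 : (‖n.y‖⁻¹ • n.y : (EuclideanSpace ℝ (Fin 3))) ≠ 0 := smul_ne_zero (inv_ne_zero hρ0.ne') hy0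
  obtain ⟨E, hE⟩ := ScarZoom.exists_localEnergy_of_typeIBound hAB'.1.1.continuousOn hAB'.2.2.2
  exact ⟨⟨_, _, _, ‖n.y‖⁻¹ • n.y⟩, ⟨⟨hAB', he0, hVe⟩, hV0⟩, he1,
    ⟨hAB'.1, ⟨E, hE⟩, singularAt_of_not_regPt hV0, _, he1, singularAt_of_not_regPt hVe⟩, rfl⟩

open Summit.NavierStokesRegularity.NavierStokesRegularity.Cruxes.ScarEnvelopeTypeI in
/-- **NORMAL FORM OF A SCAR VIOLATOR, v2 (rooted · twin-scar at every level · DSS-wall constraint at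
every level).**  If the crux item 23843 fails: there are a rate `M`, a threshold `c₁ > 1` and a ROOT
node `n₀` (twin-scar, satellite on the unit sphere) such that (i) every ROOTED node of rate `M` is,
after normalisation, a twin-scar object of rate `M` and is not `c`-DSS about any centre for
`1 < c < c₁`; (ii) from `n₀` the rooted census holds — a finite descending chain of rooted nodes to a
TAME satellite, or an infinite descending chain of rooted non-tame nodes.  (OPEN: neither branch is
excluded; 23843 / 23726 / N0 remain open; NS regularity is not proved.) -/
theorem census_of_not_scarEnvelopeTypeI₂
    (h : ¬ Summit.NavierStokesRegularity.NavierStokesRegularity.Theses.TypeIQuarterGate.ScarEnvelopeTypeI) :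
    ∃ (M c₁ : ℝ) (n₀ : TNode), 1 < c₁ ∧ RootedNode M n₀ ∧ ScarZoom.TwinScarObject M n₀.U ∧
      ‖n₀.y‖ = 1 ∧
      (∀ n : TNode, RootedNode M n →
        (∃ n' : TNode, RootedNode M n' ∧ ‖n'.y‖ = 1 ∧ ScarZoom.TwinScarObject M n'.U ∧
            n'.U = ‖n.y‖ • stPull (‖n.y‖ ^ 2) ‖n.y‖ (0 : ℝ) (0 : (EuclideanSpace ℝ (Fin 3))) n.U) ∧
          ∀ c : ℝ, 1 < c → c < c₁ → ∀ x₀ : (EuclideanSpace ℝ (Fin 3)),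
            ¬ IsDiscretelySelfSimilar c (fun t x => n.U t (x + x₀))) ∧
      ((∃ (c : ℕ → TNode) (k : ℕ), c 0 = n₀ ∧ (∀ i < k, Descends (c i) (c (i + 1))) ∧
          (∀ i ≤ k, RootedNode M (c i)) ∧ TameNode (c k)) ∨
        ∃ c : ℕ → TNode, c 0 = n₀ ∧ ∀ k, RootedNode M (c k) ∧ ¬ TameNode (c k) ∧
          Descends (c k) (c (k + 1))) := by
  obtain ⟨M, U, P, H, e, hAB, hTS, h0, he, he1⟩ := exists_abTower_of_not_scarEnvelopeTypeI h
  obtain ⟨c₁, hc₁, hdss⟩ := abTower_not_nearOneDss M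
  have hroot : RootedNode M ⟨U, P, H, e⟩ := ⟨⟨hAB, he⟩, h0⟩
  exact ⟨M, c₁, ⟨U, P, H, e⟩, hc₁, hroot, hTS, he1,
    fun n hn => ⟨twinScar_of_rootedNode hn, fun c hc hcc x₀ => hdss c hc hcc n.U n.P n.H hn.1.1 hn.2 x₀⟩,
    rooted_census hroot⟩

end Tower

end Summit.NavierStokesRegularity.NavierStokesRegularity.Cruxes.ScarEnvelopeTypeI.ZoomDictionary
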